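import Literature.Topology.FourManifolds.RegularProjectionTransport
import Literature.Topology.FourManifolds.GaussDiagramsRegularToGP
import HarnessLib

/-!
# Reading uniqueness: two regular projections of one knot read relabelled Gauss diagrams

Topic `Literature/Topology/FourManifolds`; a brick of the Reidemeister-type arguments for Gauss
diagrams of smooth knots (`GaussDiagrams.lean`: `Knot.RegularProjection`, `Knot.HasGaussDiagram`,
`GaussDiagram.IsRelabelling`). The main result is

* `Knot.RegularProjection.isRelabelling_diagram`: **any two regular projections `P₁ P₂` of the
  same knot `K` read Gauss diagrams which are relabellings of each other**,
  `P₁.diagram.IsRelabelling P₂.diagram`, i.e. `P₂.diagram = (P₁.diagram.relabel σ).rotate k` for a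
  renumbering `σ` of the chords and a change of base point `k` (GPV (2000), §1.2: a knot diagram
  determines its Gauss diagram up to the numbering of the chords and the choice of the base
  point); with the corollaries `Knot.RegularProjection.diagram_n_eq` (two regular projections of
  one knot have the same number of crossings) and `Knot.HasGaussDiagram.isRelabelling`.

## Proof sketch

The library fixes once and for all the projection used to draw diagrams (stereographic projection
from the north pole, `Knot.planeCurve`); a regular projection `P : K.RegularProjection` only
*chooses* the base point and the numbering: its data are the diagram and the strictly increasing
parameters `θ : Fin (2n) → ℝ` of the `2n` passages through crossings, all in one period
(`strictMono`, `lt_add_two_pi`), subject to `double`, `eq_or_crossing`, `heightCurve_lt`, `sign_eq`.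

1. *Chord correspondence* (`exists_chord_theta_eq`). The two passages of chord `i` of `P₁` have
   the same projection (`P₁.double`) and are not congruent modulo `2π`
   (`pos_eq_of_theta_eq_add`, `GaussDiagramsRegularToGP.lean`), so `P₂.eq_or_crossing` provides a
   chord `j` of `P₂` whose two passages are, modulo `2π`, those of `i`; the over-passage goes to
   the over-passage because heights are read from the knot (`heightCurve_lt` for both projections,
   `2π`-periodicity of `Knot.heightCurve`), and the signs agree because both are the sign of
   `det (γ'(over), γ'(under))` (`sign_eq`, periodicity of the velocity). In particular every
   passage parameter of `P₁` is congruent modulo `2π` to one of `P₂` (`exists_pos_theta_eq`).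
2. *Aligned windows* (`exists_eq_relabel_of_forall_mem_Ioo`). If all parameters of `P₁` lie in a
   window `(T - 2π, T)` and all parameters of `P₂` in the window `(T + 2πm - 2π, T + 2πm)`, then
   the congruences of step 1 are equalities up to the common shift `2πm`; the two parameter maps
   are strictly increasing with the same range up to this shift, hence have the same number of
   positions and agree position by position (`StrictMono.range_inj`); the chord correspondence
   then respects positions *as numbers*, and is a bijection `σ` of the chord indices with
   `P₂.diagram = P₁.diagram.relabel σ` (extensionality of Gauss diagrams by values).
3. *General case* (`isRelabelling_diagram`). Put the parameters of `P₁` in a window `(T - 2π, T)`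
   (`exists_forall_theta_mem_Ioo`); no parameter of `P₂` is congruent to `T` (step 1), so by
   `Knot.RegularProjection.exists_rotate_forall_mem_Ioo` (`RegularProjectionTransport.lean`: every
   arc can be made the base arc) some change of base point `P₂.rotate j` has all its parameters in
   a window `(T + 2πm - 2π, T + 2πm)`; step 2 gives `P₂.diagram.rotate j = P₁.diagram.relabel σ`,
   and rotating back by `2n - j` positions, `P₂.diagram = (P₁.diagram.relabel σ).rotate (2n - j)`.

Everything here is proved; no definition and no named fact is introduced (two private
bookkeeping lemmas on `GaussDiagram.rotate` — extensionality by values and rotating back — are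
reproved locally, their home files not being imported here).

## References

* K. Reidemeister, *Knotentheorie*, Ergebnisse der Mathematik 1, Springer (1932), Kap. I §1
  (regular projections; the diagram of a knot). [Reidemeister1932]
* M. Goussarov, M. Polyak, O. Viro, *Finite-type invariants of classical and virtual knots*,
  Topology 39 (2000) 1045–1068, §1.2 (based Gauss diagrams; dependence on the base point only up
  to rotation). [GPV2000]
* D. Rolfsen, *Knots and Links* (1976), §3.E (regular projections). [Rolfsen1976]
-/

noncomputable section

open scoped Real
open Set Function

namespace Literature.Topology.FourManifolds

namespace GaussDiagram

/-- Two Gauss diagrams with the same number of chords, the same positions (as numbers) of all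
passages and the same signs are equal (indices compared through their values, to avoid casts;
local copy of the extensionality lemma of `KhCurlRotate.lean`, not imported here). [folklore] -/
private theorem ext_of_val_aux {G₁ G₂ : GaussDiagram} (hn : G₁.n = G₂.n)
    (ho : ∀ (i : Fin G₁.n) (j : Fin G₂.n), (i : ℕ) = j → (G₁.overPos i : ℕ) = G₂.overPos j)
    (hu : ∀ (i : Fin G₁.n) (j : Fin G₂.n), (i : ℕ) = j → (G₁.underPos i : ℕ) = G₂.underPos j)
    (hs : ∀ (i : Fin G₁.n) (j : Fin G₂.n), (i : ℕ) = j → G₁.sign i = G₂.sign j) : G₁ = G₂ := by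
  obtain ⟨n₁, o₁, u₁, s₁, b₁⟩ := G₁
  obtain ⟨n₂, o₂, u₂, s₂, b₂⟩ := G₂
  simp only at hn
  subst hn
  have h1 : o₁ = o₂ := funext fun i ↦ Fin.ext (ho i i rfl)
  have h2 : u₁ = u₂ := funext fun i ↦ Fin.ext (hu i i rfl)
  have h3 : s₁ = s₂ := funext fun i ↦ hs i i rfl
  subst h1; subst h2; subst h3
  rfl

/-- **Rotating back**: after a change of base point by `j ≤ 2n` steps, a further change by
`2n - j` steps restores the based Gauss diagram (positions are counted modulo `2n`).
GPV (2000), §1.2. [cite: GPV2000, §1.2] -/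
private theorem rotate_rotate_cancel (G : GaussDiagram) {j : ℕ} (hj : j ≤ 2 * G.n) :
    (G.rotate j).rotate (2 * G.n - j) = G := by
  refine ext_of_val_aux rfl (fun i i' h ↦ ?_) (fun i i' h ↦ ?_) (fun i i' h ↦ ?_) <;>
    obtain rfl : i = i' := Fin.ext h
  · rw [rotate_overPos, val_rotPos, rotate_overPos, val_rotPos]
    show (((G.overPos i : ℕ) + j) % (2 * G.n) + (2 * G.n - j)) % (2 * G.n) = G.overPos i
    rw [Nat.mod_add_mod, show (G.overPos i : ℕ) + j + (2 * G.n - j) = G.overPos i + 2 * G.n by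
      omega, Nat.add_mod_right, Nat.mod_eq_of_lt (G.overPos i).isLt]
  · rw [rotate_underPos, val_rotPos, rotate_underPos, val_rotPos]
    show (((G.underPos i : ℕ) + j) % (2 * G.n) + (2 * G.n - j)) % (2 * G.n) = G.underPos i
    rw [Nat.mod_add_mod, show (G.underPos i : ℕ) + j + (2 * G.n - j) = G.underPos i + 2 * G.n by
      omega, Nat.add_mod_right, Nat.mod_eq_of_lt (G.underPos i).isLt]
  · rfl

end GaussDiagram

/-- Two strictly increasing finite sequences of reals with the same set of values have the same
length and agree term by term (indices compared through their values). [folklore] -/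
private theorem strictMono_range_eq {N₁ N₂ : ℕ} {f₁ : Fin N₁ → ℝ} {f₂ : Fin N₂ → ℝ}
    (h₁ : StrictMono f₁) (h₂ : StrictMono f₂) (h : range f₁ = range f₂) :
    N₁ = N₂ ∧ ∀ (p : Fin N₁) (q : Fin N₂), (p : ℕ) = q → f₂ q = f₁ p := by
  classical
  obtain rfl : N₁ = N₂ := by
    have e₁ : (Finset.univ.image f₁).card = N₁ := by
      rw [Finset.card_image_of_injective _ h₁.injective, Finset.card_univ, Fintype.card_fin]
    have e₂ : (Finset.univ.image f₂).card = N₂ := by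
      rw [Finset.card_image_of_injective _ h₂.injective, Finset.card_univ, Fintype.card_fin]
    have himage : Finset.univ.image f₁ = Finset.univ.image f₂ := Finset.coe_inj.1 (by
      rw [Finset.coe_image, Finset.coe_image, Finset.coe_univ, Finset.coe_univ, image_univ,
        image_univ, h])
    rw [himage, e₂] at e₁
    exact e₁.symm
  refine ⟨rfl, fun p q hpq ↦ ?_⟩
  obtain rfl : p = q := Fin.ext hpq
  exact congrFun ((h₁.range_inj h₂).1 h).symm p

namespace Knot.RegularProjection

variable {K : Knot}

/-! ### The chord correspondence between two regular projections of one knot -/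

/-- **Chord correspondence.** For two regular projections `P₁ P₂` of the same knot and a chord `i`
of the diagram read by `P₁`, some chord `j` of the diagram read by `P₂` has its over-passage
parameter congruent modulo `2π` to that of `i`, its under-passage parameter congruent to that of
`i`, and the same sign: both projections read the same plane curve, whose double points modulo the
period are listed by either (`double`, `eq_or_crossing`), over/under being decided by the heights
of the knot (`heightCurve_lt`) and the sign by the velocities of the plane curve (`sign_eq`), all
`2π`-periodic. Reidemeister (1932), Kap. I §1; GPV (2000), §1.2. [cite: GPV2000, §1.2] -/
theorem exists_chord_theta_eq (P₁ P₂ : K.RegularProjection) (i : Fin P₁.diagram.n) :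
    ∃ (j : Fin P₂.diagram.n) (k l : ℤ),
      P₂.θ (P₂.diagram.overPos j) = P₁.θ (P₁.diagram.overPos i) + k * (2 * π) ∧
      P₂.θ (P₂.diagram.underPos j) = P₁.θ (P₁.diagram.underPos i) + l * (2 * π) ∧
      P₂.diagram.sign j = P₁.diagram.sign i := by
  rcases P₂.eq_or_crossing _ _ (P₁.double i) with ⟨k, hk⟩ | ⟨j, k, l, hset⟩
  · -- the two passages of a chord are not congruent modulo `2π`
    exact absurd (P₁.pos_eq_of_theta_eq_add hk) (P₁.diagram.overPos_ne_underPos i i).symm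
  · have hH : ∀ (x : ℝ) (m : ℤ), K.heightCurve (x + m * (2 * π)) = K.heightCurve x :=
      fun x m ↦ (K.periodic_heightCurve.int_mul m) x
    have hD : ∀ (x : ℝ) (m : ℤ), deriv K.planeCurve (x + m * (2 * π)) = deriv K.planeCurve x :=
      fun x m ↦ ((periodic_deriv_of_periodic K.periodic_planeCurve).int_mul m) x
    rcases Set.pair_eq_pair_iff.1 hset with ⟨h1, h2⟩ | ⟨h1, h2⟩
    · -- over-passage to over-passage: the signs agree
      refine ⟨j, k, l, h1.symm, h2.symm, Units.ext ?_⟩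
      rw [P₂.sign_eq j, P₁.sign_eq i, ← h1, ← h2, hD, hD]
    · -- over-passage to under-passage: impossible, heights are read from the knot
      exfalso
      have h₁ := P₁.heightCurve_lt i
      have h₂ := P₂.heightCurve_lt j
      rw [← h1, ← h2, hH, hH] at h₂
      exact lt_asymm h₁ h₂

/-- Every passage parameter of one regular projection of a knot is congruent modulo `2π` to a
passage parameter of any other regular projection of the same knot. GPV (2000), §1.2.
[cite: GPV2000, §1.2] -/
theorem exists_pos_theta_eq (P₁ P₂ : K.RegularProjection) (p : Fin (2 * P₁.diagram.n)) :
    ∃ (q : Fin (2 * P₂.diagram.n)) (k : ℤ), P₂.θ q = P₁.θ p + k * (2 * π) := by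
  obtain ⟨i, rfl | rfl⟩ := P₁.diagram.exists_chord p
  · obtain ⟨j, k, l, h1, -, -⟩ := exists_chord_theta_eq P₁ P₂ i
    exact ⟨_, k, h1⟩
  · obtain ⟨j, k, l, -, h2, -⟩ := exists_chord_theta_eq P₁ P₂ i
    exact ⟨_, l, h2⟩

/-- The passage parameters of a regular projection all lie in some open window of length `2π`
(they increase and span less than a period, `lt_add_two_pi`). [folklore] -/
theorem exists_forall_theta_mem_Ioo (P : K.RegularProjection) :
    ∃ T : ℝ, ∀ p, P.θ p ∈ Ioo (T - 2 * π) T := by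
  by_cases hn : 2 * P.diagram.n = 0
  · exact ⟨0, fun p ↦ absurd p.isLt (by omega)⟩
  · obtain ⟨p₀, hp₀⟩ : ∃ p₀ : Fin (2 * P.diagram.n), (p₀ : ℕ) = 0 := ⟨⟨0, by omega⟩, rfl⟩
    obtain ⟨p₁, hp₁⟩ : ∃ p₁ : Fin (2 * P.diagram.n), (p₁ : ℕ) = 2 * P.diagram.n - 1 :=
      ⟨⟨2 * P.diagram.n - 1, by omega⟩, rfl⟩
    refine ⟨(P.θ p₁ + P.θ p₀ + 2 * π) / 2, fun p ↦ ?_⟩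
    have h0 : P.θ p₀ ≤ P.θ p := P.strictMono.monotone (Fin.le_def.2 (by omega))
    have h1 : P.θ p ≤ P.θ p₁ := P.strictMono.monotone (Fin.le_def.2 (by have := p.isLt; omega))
    have h2 := P.lt_add_two_pi p₁ p₀
    constructor <;> linarith

/-- Two reals congruent modulo `2π`, one in the window `(T - 2π, T)` and the other in the window
`(T + 2πm - 2π, T + 2πm)`, differ by exactly `m` periods. [folklore] -/
private theorem int_eq_of_mem_Ioo {T x y : ℝ} {k m : ℤ} (hx : x ∈ Ioo (T - 2 * π) T)
    (hy : y ∈ Ioo (T + m * (2 * π) - 2 * π) (T + m * (2 * π))) (h : y = x + k * (2 * π)) :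
    k = m := by
  obtain ⟨hx1, hx2⟩ := hx
  obtain ⟨hy1, hy2⟩ := hy
  rw [h] at hy1 hy2
  have hπ : (0 : ℝ) < 2 * π := by positivity
  have hk1 : (k : ℝ) < m + 1 := by
    by_contra hc
    push Not at hc
    nlinarith
  have hk2 : (m : ℝ) - 1 < k := by
    by_contra hc
    push Not at hc
    nlinarith
  have h1 : k < m + 1 := by exact_mod_cast hk1
  have h2 : m - 1 < k := by exact_mod_cast hk2
  omega

/-! ### Aligned windows: the diagrams differ by a renumbering of the chords -/

/-- **Aligned regular projections read the same diagram up to renumbering of the chords.** If all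
passage parameters of `P₁` lie in a window `(T - 2π, T)` and all those of `P₂` in the window
`(T + 2πm - 2π, T + 2πm)` (the two base points lie on "the same arc"), then the two projections
have the same number of crossings, the same parameters position by position up to the shift
`2πm`, and `P₂.diagram = P₁.diagram.relabel σ` for a permutation `σ` of the chord indices.
GPV (2000), §1.2. [cite: GPV2000, §1.2] -/
theorem exists_eq_relabel_of_forall_mem_Ioo (P₁ P₂ : K.RegularProjection) {T : ℝ} {m : ℤ}
    (hT₁ : ∀ p, P₁.θ p ∈ Ioo (T - 2 * π) T)
    (hT₂ : ∀ q, P₂.θ q ∈ Ioo (T + m * (2 * π) - 2 * π) (T + m * (2 * π))) :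
    ∃ σ : Equiv.Perm (Fin P₁.diagram.n), P₂.diagram = P₁.diagram.relabel σ := by
  -- the congruences of `exists_pos_theta_eq` are equalities up to the common shift `2πm`
  have hA : ∀ p, ∃ q, P₂.θ q = P₁.θ p + m * (2 * π) := fun p ↦ by
    obtain ⟨q, k, hk⟩ := exists_pos_theta_eq P₁ P₂ p
    obtain rfl := int_eq_of_mem_Ioo (hT₁ p) (hT₂ q) hk
    exact ⟨q, hk⟩
  have hB : ∀ q, ∃ p, P₂.θ q = P₁.θ p + m * (2 * π) := fun q ↦ by
    obtain ⟨p, k, hk⟩ := exists_pos_theta_eq P₂ P₁ q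
    have hk' : P₂.θ q = P₁.θ p + ((-k : ℤ) : ℝ) * (2 * π) := by push_cast; linarith
    have hkm : ((-k : ℤ) : ℝ) = m := by exact_mod_cast int_eq_of_mem_Ioo (hT₁ p) (hT₂ q) hk'
    exact ⟨p, by rw [hk', hkm]⟩
  -- hence the shifted parameters of `P₁` and the parameters of `P₂` have the same range
  have hrange : range (fun p ↦ P₁.θ p + m * (2 * π)) = range P₂.θ := by
    ext x
    constructor
    · rintro ⟨p, rfl⟩
      obtain ⟨q, hq⟩ := hA p
      exact ⟨q, hq⟩
    · rintro ⟨q, rfl⟩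
      obtain ⟨p, hp⟩ := hB q
      exact ⟨p, hp.symm⟩
  have hmono : StrictMono (fun p ↦ P₁.θ p + m * (2 * π)) := fun p q hpq ↦ by
    show P₁.θ p + m * (2 * π) < P₁.θ q + m * (2 * π)
    linarith [P₁.strictMono hpq]
  obtain ⟨hN, hθ⟩ := strictMono_range_eq hmono P₂.strictMono hrange
  have hn : P₁.diagram.n = P₂.diagram.n := by omega
  -- the chord correspondence respects positions as numbers
  have hC : ∀ i₂ : Fin P₂.diagram.n, ∃ i₁ : Fin P₁.diagram.n,
      (P₁.diagram.overPos i₁ : ℕ) = P₂.diagram.overPos i₂ ∧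
      (P₁.diagram.underPos i₁ : ℕ) = P₂.diagram.underPos i₂ ∧
      P₁.diagram.sign i₁ = P₂.diagram.sign i₂ := fun i₂ ↦ by
    obtain ⟨i₁, k, l, ho, hu, hs⟩ := exists_chord_theta_eq P₂ P₁ i₂
    refine ⟨i₁, ?_, ?_, hs⟩
    · have h := hθ (Fin.cast hN.symm (P₂.diagram.overPos i₂)) (P₂.diagram.overPos i₂) rfl
      have := P₁.pos_eq_of_theta_eq_add (p := P₁.diagram.overPos i₁)
        (q := Fin.cast hN.symm (P₂.diagram.overPos i₂)) (m := m + k) (by rw [ho, h]; push_cast; ring)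
      exact congrArg Fin.val this
    · have h := hθ (Fin.cast hN.symm (P₂.diagram.underPos i₂)) (P₂.diagram.underPos i₂) rfl
      have := P₁.pos_eq_of_theta_eq_add (p := P₁.diagram.underPos i₁)
        (q := Fin.cast hN.symm (P₂.diagram.underPos i₂)) (m := m + l) (by rw [hu, h]; push_cast; ring)
      exact congrArg Fin.val this
  choose c hc using hC
  -- the renumbering of the chords
  have hinj : Injective fun i : Fin P₁.diagram.n ↦ c (Fin.cast hn i) := by
    intro i i' h
    have h1 := (hc (Fin.cast hn i)).1
    have h2 := (hc (Fin.cast hn i')).1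
    simp only at h
    rw [h] at h1
    exact Fin.cast_injective hn (P₂.diagram.overPos_injective (Fin.ext (h1.symm.trans h2)))
  obtain ⟨σ, hσ⟩ : ∃ σ : Equiv.Perm (Fin P₁.diagram.n), ∀ i, σ i = c (Fin.cast hn i) :=
    ⟨Equiv.ofBijective _ (Finite.injective_iff_bijective.1 hinj), fun _ ↦ rfl⟩
  refine ⟨σ, GaussDiagram.ext_of_val_aux hn.symm (fun i j hij ↦ ?_) (fun i j hij ↦ ?_)
    (fun i j hij ↦ ?_)⟩
  · have hj : Fin.cast hn j = i := Fin.ext hij.symm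
    show (P₂.diagram.overPos i : ℕ) = P₁.diagram.overPos (σ j)
    rw [hσ, (hc _).1, hj]
  · have hj : Fin.cast hn j = i := Fin.ext hij.symm
    show (P₂.diagram.underPos i : ℕ) = P₁.diagram.underPos (σ j)
    rw [hσ, (hc _).2.1, hj]
  · have hj : Fin.cast hn j = i := Fin.ext hij.symm
    show P₂.diagram.sign i = P₁.diagram.sign (σ j)
    rw [hσ, (hc _).2.2, hj]

/-! ### Reading uniqueness -/

/-- **Reading uniqueness for Gauss diagrams of one knot.** Any two regular projections `P₁ P₂` of
the same knot `K` (stereographic projection from the north pole, with any choices of base point and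
of numbering of the crossings) read Gauss diagrams which are relabellings of each other:
`P₂.diagram = (P₁.diagram.relabel σ).rotate k` for a renumbering `σ` of the chords and a change of
base point `k`. Both projections read the same plane curve, so the same double points modulo the
period, with over/under and signs read from the knot; after a change of base point of `P₂`
(`exists_rotate_forall_mem_Ioo`) the two lists of passage parameters occupy the same window and
then agree position by position (`exists_eq_relabel_of_forall_mem_Ioo`). Reidemeister (1932),
Kap. I §1; GPV (2000), §1.2 (a knot diagram determines its based Gauss diagram up to rotation of
the base point and numbering of the chords). [cite: GPV2000, §1.2] -/
theorem isRelabelling_diagram (P₁ P₂ : K.RegularProjection) :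
    P₁.diagram.IsRelabelling P₂.diagram := by
  obtain ⟨T, hT⟩ := exists_forall_theta_mem_Ioo P₁
  have hπ : (0 : ℝ) < 2 * π := by positivity
  -- no passage parameter of `P₂` is congruent to `T`
  have ht₀ : ∀ q (m : ℤ), P₂.θ q ≠ T + m * (2 * π) := by
    intro q m hq
    obtain ⟨p, k, hk⟩ := exists_pos_theta_eq P₂ P₁ q
    obtain ⟨h1, h2⟩ := hT p
    rw [hq] at hk
    have hlt : ((m + k : ℤ) : ℝ) < 0 := by
      by_contra hc
      push Not at hc
      push_cast at hc
      nlinarith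
    have hgt : (-1 : ℝ) < ((m + k : ℤ) : ℝ) := by
      by_contra hc
      push Not at hc
      push_cast at hc
      nlinarith
    have a : m + k < 0 := by exact_mod_cast hlt
    have b : -1 < m + k := by exact_mod_cast hgt
    omega
  -- move the base point of `P₂` to the arc through `T`
  obtain ⟨j, hj, m, hm⟩ := P₂.exists_rotate_forall_mem_Ioo ht₀
  obtain ⟨σ, hσ⟩ := exists_eq_relabel_of_forall_mem_Ioo P₁ (P₂.rotate j hj) hT hm
  rw [rotate_diagram] at hσ
  exact ⟨σ, 2 * P₂.diagram.n - j, by rw [← hσ, GaussDiagram.rotate_rotate_cancel _ hj]⟩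

/-- **Two regular projections of one knot have the same number of crossings.**
Reidemeister (1932), Kap. I §1. [cite: Reidemeister1932, Kap. I §1] -/
theorem diagram_n_eq (P₁ P₂ : K.RegularProjection) : P₁.diagram.n = P₂.diagram.n := by
  obtain ⟨σ, k, h⟩ := isRelabelling_diagram P₁ P₂
  rw [h]
  rfl

end Knot.RegularProjection

/-- **The Gauss diagram of a knot is well defined up to relabelling**: two Gauss diagrams read off
the same knot (`Knot.HasGaussDiagram`) differ by a renumbering of the chords and a change of base
point. GPV (2000), §1.2. [cite: GPV2000, §1.2] -/
theorem Knot.HasGaussDiagram.isRelabelling {K : Knot} {G G' : GaussDiagram}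
    (h : K.HasGaussDiagram G) (h' : K.HasGaussDiagram G') : G.IsRelabelling G' := by
  obtain ⟨P, rfl⟩ := h
  obtain ⟨P', rfl⟩ := h'
  exact P.isRelabelling_diagram P'

end Literature.Topology.FourManifolds
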